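import Summits.Ventures.CertifiedManyBodySolver.Theorems.M3x2EdgeSplitSymReplayLocalA
import HarnessLib

/-!
# SymReplay — the ZERO-FILTERED executed pipe `canonNFZV` and the LOCAL closing theorems, one-call and sharded (T16b; hub-lb-sym-eng-3)

(L1) zero filter (sym-ref-1 g1): after `collect`, entries with coefficient `0` are dropped BEFORE canonicalisation (`dropZeros`;
operator unchanged) — on dense rows ≈ ×500.  (L3) local commutators (`rhsPolyL`, T16a).  Closing theorems:
one-call `energyDensity_ge_symValueLV : symCheckLV K = true → symValue K ≤ e₀(1,0,8,7/8)` and sharded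
`energyDensity_ge_of_shardsLV` (T12 contract with the LOCAL base shard and the zero-filtered executed pipe), both through
the landed expansion-form soundness `wardD4CertGe_of_expansion` and `polyOp_rhsPolyL_eq`.
No summit or crux statement is proved here; no certificate beyond toys is replayed; nothing here predicts superconductivity.
-/

noncomputable section

namespace Summit.Ventures.CertifiedManyBodySolver.Theorems.SymReplay

open Matrix Finset
open Literature.MathematicalPhysics.QuantumLattice
open Literature.MathematicalPhysics.QuantumLattice.HubbardWave0
open Literature.MathematicalPhysics.QuantumLattice.ThermodynamicLimit
open Literature.Probability.LatticeModels
open Literature.MathematicalPhysics.QuantumManyBody.StateRelaxation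
open Summit.Ventures.CertifiedManyBodySolver.Theorems.WardSlot
open scoped ComplexOrder BigOperators

/-! ##### (L1) The zero filter -/

/-- Drop the terms with coefficient `0`. -/
def dropZeros (p : QPoly) : QPoly := p.filter fun t => !decide (t.1 = 0)

/-- Dropping zero-coefficient terms does not change the operator. -/
theorem polyOp_dropZeros (Λ' : Finset (Site 2)) : ∀ (p : QPoly), polyOp Λ' (dropZeros p) = polyOp Λ' p
  | [] => rfl
  | t :: p => by
    rw [dropZeros, List.filter_cons]
    by_cases h : t.1 = 0
    · have hb : (!decide (t.1 = 0)) = false := by rw [h]; rfl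
      rw [hb]
      simp only [Bool.false_eq_true, if_false]
      rw [← dropZeros, polyOp_dropZeros Λ' p, polyOp_cons, h, Rat.cast_zero, zero_smul, zero_add]
    · have hb : (!decide (t.1 = 0)) = true := by simp [h]
      rw [hb]
      simp only [if_true]
      rw [polyOp_cons, ← dropZeros, polyOp_dropZeros Λ' p, polyOp_cons]

/-- Dropping terms keeps supports. -/
theorem PSupp.dropZeros {p : QPoly} {Λ : Finset (Site 2)} (hp : PSupp p Λ) : PSupp (dropZeros p) Λ :=
  fun t ht => hp t (List.mem_of_mem_filter ht)

/-- **The zero-filtered EXECUTED per-shard pipe**: normal-order, collect, drop zeros, canonicalise (executed corner). -/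
def canonNFZV (frame : List (Site 2)) (p : QPoly) : QPoly :=
  (dropZeros (collect (nfPoly p))).flatMap (canonTermAV (minCornerP frame) frame)

/-- Its identification uses. -/
def canonNFZUses (frame : List (Site 2)) (p : QPoly) : List IdUse :=
  (dropZeros (collect (nfPoly p))).flatMap (usesOfTerm (flatSite (minCorner frame)) frame)

/-- `p ≡ canonNFZV p` up to its identification uses (as operators, for `p` supported in `Λ' ⊇ frame`). -/
theorem canonNFZV_expansion {Λ' : Finset (Site 2)} (frame : List (Site 2)) (hfr : frame.toFinset ⊆ Λ') (p : QPoly)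
    (hp : PSupp p Λ') :
    polyOp Λ' p = polyOp Λ' (canonNFZV frame p) + ((canonNFZUses frame p).map (useOp Λ')).sum := by
  have h := sum_canonTerm stub_nfFaithful (flatSite (minCorner frame)) frame hfr (dropZeros (collect (nfPoly p)))
  have hc : polyOp Λ' (dropZeros (collect (nfPoly p))) = polyOp Λ' p := by
    rw [polyOp_dropZeros, polyOp_eq_evalP, collect_eval, ← polyOp_eq_evalP, polyOp_nfPoly stub_nfFaithful _ _ hp]
  rw [canonNFZV, canonNFZUses, canonTermAV_eq, mkSite_minCornerP_eq, ← h, hc]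
  abel

/-- The words of the uses of `canonNFZV p` are supported with `p`. -/
theorem canonNFZUses_supp (frame : List (Site 2)) (p : QPoly) {Λ : Finset (Site 2)} (hp : PSupp p Λ) :
    ∀ e ∈ canonNFZUses frame p, SuppIn e.u Λ := by
  intro e he
  rw [canonNFZUses, List.mem_flatMap] at he
  obtain ⟨t, ht, he⟩ := he
  rw [(usesOfTerm_spec e he).1]
  exact hp.nfPoly.collect.dropZeros t ht

/-! ##### One-call LOCAL executed checker -/

/-- The local residual `LHS − RHS_L`. -/
def residualL (K : SymCert) : QPoly := psub (lhsPoly K) (rhsPolyL K)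

/-- The identity test: zero-filtered executed canonical pipe on the LOCAL residual (plain `collect ∘ nfPoly` when
`useCanon = false`). -/
def identityOKLV (K : SymCert) : Bool :=
  if K.useCanon then isZero (canonNFZV K.frame (residualL K)) else isZero (collect (nfPoly (residualL K)))

/-- **The local executed checker** (support-pruned commutators, zero filter, executed corner). -/
def symCheckLV (K : SymCert) : Bool := wellFormed K && identityOKLV K

/-- `thicken {0} 1 ⊆ frame` from `wellFormed`. -/
theorem thicken_zero_subset_of_wellFormed (K : SymCert) (hwf : wellFormed K = true) :
    thicken ({0} : Finset (Site 2)) 1 ⊆ K.frame.toFinset := by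
  have hwf' := hwf
  simp only [wellFormed, Bool.and_eq_true] at hwf'
  obtain ⟨⟨⟨⟨⟨⟨⟨⟨⟨⟨⟨⟨⟨-, -⟩, hn0⟩, -⟩, -⟩, -⟩, -⟩, -⟩, -⟩, -⟩, -⟩, -⟩, -⟩, -⟩ := hwf'
  have h : subSites (thick [0]) K.frame = true := by simpa [thick] using hn0
  have h' := thicken_subset_of_thick h
  simpa using h'

/-- The local residual is supported in the frame. -/
theorem PSupp_residualL (K : SymCert) (hwf : wellFormed K = true) : PSupp (residualL K) K.frame.toFinset :=
  (PSupp_lhsPoly K (thicken_zero_subset_of_wellFormed K hwf)).psub (PSupp_rhsPolyL K hwf)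

/-- **The local executed checker is SOUND.** -/
theorem wardD4CertGe_of_symCheckLV (K : SymCert) (hK : symCheckLV K = true) : WardD4CertGe ((symValue K : ℚ) : ℝ) := by
  rw [symCheckLV, Bool.and_eq_true] at hK
  obtain ⟨hwf, hid⟩ := hK
  have hres := PSupp_residualL K hwf
  rw [identityOKLV] at hid
  cases hc : K.useCanon
  · rw [hc] at hid
    simp only [Bool.false_eq_true, if_false] at hid
    refine wardD4CertGe_of_expansion K hwf [] (fun e he => absurd he (by simp)) ?_
    have hFL : K.frame.toFinset ⊆ (envelope K []).toList.toFinset := by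
      rw [Finset.toList_toFinset]; exact (subset_thicken _ 1).trans (thicken_subset_envelope K [])
    have h0 := polyOp_eq_zero_of_isZero (envelope K []).toList.toFinset _ hid
    rw [polyOp_eq_evalP, collect_eval, ← polyOp_eq_evalP, polyOp_nfPoly stub_nfFaithful _ _ (hres.mono hFL), residualL,
      polyOp_psub, polyOp_rhsPolyL_eq K hwf hFL, sub_eq_zero] at h0
    rw [h0, List.map_nil, List.sum_nil, add_zero]
  · rw [hc] at hid
    simp only [if_true] at hid
    let U := canonNFZUses K.frame (residualL K)
    refine wardD4CertGe_of_expansion K hwf U (canonNFZUses_supp K.frame _ hres) ?_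
    have hFL : K.frame.toFinset ⊆ (envelope K U).toList.toFinset := by
      rw [Finset.toList_toFinset]; exact (subset_thicken _ 1).trans (thicken_subset_envelope K U)
    have hexp := canonNFZV_expansion K.frame hFL (residualL K) (hres.mono hFL)
    rw [polyOp_eq_zero_of_isZero _ _ hid, zero_add, residualL, polyOp_psub, polyOp_rhsPolyL_eq K hwf hFL] at hexp
    exact eq_add_of_sub_eq' hexp

/-- **One-call LOCAL closing theorem**: `symCheckLV K = true ⇒ symValue K ≤ e₀(1,0,8,7/8)`. -/
theorem energyDensity_ge_symValueLV (K : SymCert) (hK : symCheckLV K = true) :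
    ((symValue K : ℚ) : ℝ) ≤ energyDensityTT' 1 0 8 (7 / 8) :=
  energyDensity_ge_of_windowSound_cert _ WardSlot.stub_wardWindowSound (wardD4CertGe_of_symCheckLV K hK)

/-! ##### Sharded LOCAL replay (T12 contract with the local base shard and the zero-filtered executed pipe) -/

/-- `RHS_L` without the matrix-form Gram blocks. -/
def rhsNonBlockL (K : SymCert) : QPoly :=
  (K.gram.flatMap fun g => pscale g.1 (pmul (padj g.2) g.2)) ++
    (K.eom.flatMap fun B => comm (hamPoly (localFrame B)) B) ++
    (K.moves.flatMap fun mv => [(mv.z, moveWord mv.γ mv.v mv.u), (-mv.z, mv.u)]) ++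
    K.charged ++
    (K.wardP.flatMap fun X => comm (spinPlusPoly (sitesOf X)) X) ++
    (K.wardM.flatMap fun X => comm (spinMinusPoly (sitesOf X)) X) ++
    (K.antiH.flatMap fun t => pscale t.1 (psub (padj t.2) t.2)) ++
    K.slack

/-- `RHS_L = (RHS_L without blocks) + blocks`, as operators. -/
theorem polyOp_rhsPolyL_split (Λ' : Finset (Site 2)) (K : SymCert) :
    polyOp Λ' (rhsPolyL K) = polyOp Λ' (rhsNonBlockL K) + polyOp Λ' (K.gramM.flatMap gramBlockPoly) := by
  simp only [rhsPolyL, rhsNonBlockL, polyOp_append]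
  abel

/-- `rhsPolyL = rhsNonBlockL` with the blocks inserted after the SOS part, as LISTS: supports transfer. -/
theorem PSupp_rhsNonBlockL (K : SymCert) (hwf : wellFormed K = true) : PSupp (rhsNonBlockL K) K.frame.toFinset := by
  have h := PSupp_rhsPolyL K hwf
  intro t ht
  apply h t
  simp only [rhsPolyL, rhsNonBlockL, List.mem_append] at ht ⊢
  tauto

/-- The LOCAL base shard. -/
def baseShardL (K : SymCert) : QPoly := psub (lhsPoly K) (rhsNonBlockL K)

/-- The LOCAL shard list: local base shard, then the block row chunks (as in T12b). -/
def shardPolysL (K : SymCert) (c : ℕ) : List QPoly := baseShardL K :: K.gramM.flatMap (blockShardPolys c)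

/-- The local shards sum to `LHS − RHS` (as operators in any window containing the frame). -/
theorem sum_shardPolysL {Λ' : Finset (Site 2)} (K : SymCert) (hwf : wellFormed K = true) (hFL : K.frame.toFinset ⊆ Λ')
    (c : ℕ) : ((shardPolysL K c).map (polyOp Λ')).sum = polyOp Λ' (lhsPoly K) - polyOp Λ' (rhsPoly K) := by
  rw [shardPolysL, List.map_cons, List.sum_cons, sum_flatMap_blockShardPolys, baseShardL, polyOp_psub,
    ← polyOp_rhsPolyL_eq K hwf hFL, polyOp_rhsPolyL_split]
  abel

/-- **Shard `j`, computed alone** (local base shard for `j = 0`, else T12c's block walk). -/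
def shardPolyAtLFast (K : SymCert) (c : ℕ) : ℕ → QPoly
  | 0 => baseShardL K
  | j + 1 => shardsFrom c K.gramM j

/-- The fast local accessor agrees with indexing `shardPolysL`. -/
theorem shardPolyAtLFast_eq (K : SymCert) (c j : ℕ) : shardPolyAtLFast K c j = ((shardPolysL K c)[j]?).getD [] := by
  cases j with
  | zero => rfl
  | succ j => rw [shardPolyAtLFast, shardPolysL, List.getElem?_cons_succ, shardsFrom_eq]

/-- The local shard list has `shardCount K c` entries. -/
theorem shardCount_eq_lengthL (K : SymCert) (c : ℕ) : shardCount K c = (shardPolysL K c).length := by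
  rw [shardCount_eq, shardPolys, shardPolysL, List.length_cons, List.length_cons]

/-- **What ONE farm call proves about local shard `j`** (zero-filtered executed pipe). -/
def shardOKLV (K : SymCert) (c j : ℕ) (P : QPoly) : Bool :=
  psuppIn P K.frame && isZero (psub (canonNFZV K.frame (shardPolyAtLFast K c j)) P)

/-- The per-call facts, local executed form (structural on the literal partial list). -/
def ShardFactsLV (K : SymCert) (c : ℕ) : ℕ → List QPoly → Prop
  | _, [] => True
  | j, P :: Ps => shardOKLV K c j P = true ∧ ShardFactsLV K c (j + 1) Ps

/-- Two-list facts with the zero-filtered pipe (internal). -/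
def Facts₂Z (K : SymCert) : List QPoly → List QPoly → Prop
  | [], [] => True
  | Q :: Qs, P :: Ps => (psuppIn P K.frame && isZero (psub (canonNFZV K.frame Q) P)) = true ∧ Facts₂Z K Qs Ps
  | _, _ => False

/-- Index-based local facts give the two-list facts on the corresponding suffix. -/
theorem facts₂Z_of_shardFactsLV (K : SymCert) (c : ℕ) :
    ∀ (Ps : List QPoly) (j : ℕ), ((shardPolysL K c).drop j).length = Ps.length →
      ShardFactsLV K c j Ps → Facts₂Z K ((shardPolysL K c).drop j) Ps
  | [], j, hl, _ => by
    rw [List.length_nil, List.length_eq_zero_iff] at hl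
    rw [hl]; trivial
  | P :: Ps, j, hl, hf => by
    have hj : j < (shardPolysL K c).length := by
      rw [List.length_drop, List.length_cons] at hl; omega
    rw [List.drop_eq_getElem_cons hj]
    have hQ : shardPolyAtLFast K c j = (shardPolysL K c)[j] := by
      rw [shardPolyAtLFast_eq, List.getElem?_eq_getElem hj]; rfl
    refine ⟨?_, facts₂Z_of_shardFactsLV K c Ps (j + 1) ?_ hf.2⟩
    · rw [← hQ]; exact hf.1
    · have := hl; rw [List.drop_eq_getElem_cons hj, List.length_cons, List.length_cons] at this; omega

/-- Assembly of the two-list facts with the zero-filtered pipe. -/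
theorem facts₂Z_sum {Λ' : Finset (Site 2)} (K : SymCert) (hFL : K.frame.toFinset ⊆ Λ') :
    ∀ (Qs Ps : List QPoly), Facts₂Z K Qs Ps → (∀ Q ∈ Qs, PSupp Q K.frame.toFinset) →
      (Qs.map (polyOp Λ')).sum = polyOp Λ' Ps.flatten + ((Qs.flatMap (canonNFZUses K.frame)).map (useOp Λ')).sum ∧
        PSupp Ps.flatten K.frame.toFinset
  | [], [], _, _ => by simp [PSupp]
  | [], _ :: _, h, _ => absurd h (by simp [Facts₂Z])
  | _ :: _, [], h, _ => absurd h (by simp [Facts₂Z])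
  | Q :: Qs, P :: Ps, h, hQ => by
    obtain ⟨h1, h2⟩ := h
    rw [Bool.and_eq_true] at h1
    obtain ⟨hP, hz⟩ := h1
    have hPs := PSupp_of_psuppIn hP
    obtain ⟨ih, ihs⟩ := facts₂Z_sum K hFL Qs Ps h2 (fun Q' hQ' => hQ Q' (List.mem_cons_of_mem _ hQ'))
    have hQF : PSupp Q K.frame.toFinset := hQ Q List.mem_cons_self
    have hcanon := canonNFZV_expansion K.frame hFL Q (hQF.mono hFL)
    have hzero := polyOp_eq_zero_of_isZero Λ' _ hz
    rw [polyOp_psub, sub_eq_zero] at hzero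
    refine ⟨?_, hPs.append ihs⟩
    rw [List.map_cons, List.sum_cons, List.flatten_cons, polyOp_append, List.flatMap_cons, List.map_append,
      List.sum_append, ih, hcanon, hzero]
    abel

/-- **SHARDED LOCAL REPLAY IS SOUND** (local base shard + block row chunks; zero-filtered executed pipe per shard). -/
theorem wardD4CertGe_of_shardsLV (K : SymCert) (hwf : wellFormed K = true) (c : ℕ) (Ps : List QPoly)
    (hcount : shardCount K c = Ps.length) (hfacts : ShardFactsLV K c 0 Ps)
    (hfin : isZero (canonNFZV K.frame Ps.flatten) = true) : WardD4CertGe ((symValue K : ℚ) : ℝ) := by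
  have hgM : ∀ B ∈ K.gramM, ∀ q ∈ B.basis, PSupp q K.frame.toFinset := fun B hB q hq => by
    have hwf' := hwf
    simp only [wellFormed, Bool.and_eq_true] at hwf'
    obtain ⟨⟨⟨⟨⟨⟨⟨⟨⟨⟨⟨⟨⟨-, -⟩, -⟩, -⟩, -⟩, -⟩, hgM⟩, -⟩, -⟩, -⟩, -⟩, -⟩, -⟩, -⟩ := hwf'
    have h := List.all_eq_true.1 hgM B hB
    simp only [gramBlockOK, Bool.and_eq_true, List.all_eq_true] at h
    exact PSupp_of_psuppIn (h.2 q hq)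
  have hQ : ∀ Q ∈ shardPolysL K c, PSupp Q K.frame.toFinset := by
    intro Q hQ
    rw [shardPolysL, List.mem_cons] at hQ
    rcases hQ with rfl | hQ
    · exact (PSupp_lhsPoly K (thicken_zero_subset_of_wellFormed K hwf)).psub (PSupp_rhsNonBlockL K hwf)
    · rw [List.mem_flatMap] at hQ
      obtain ⟨B, hB, hQ⟩ := hQ
      exact PSupp_blockShardPolys c B (hgM B hB) Q hQ
  have hlen : (shardPolysL K c).length = Ps.length := (shardCount_eq_lengthL K c).symm.trans hcount
  have hF : Facts₂Z K (shardPolysL K c) Ps := by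
    have h := facts₂Z_of_shardFactsLV K c Ps 0 (by rw [List.drop_zero]; exact hlen) hfacts
    rwa [List.drop_zero] at h
  let U := (shardPolysL K c).flatMap (canonNFZUses K.frame) ++ canonNFZUses K.frame Ps.flatten
  have hL : (envelope K U).toList.toFinset = envelope K U := Finset.toList_toFinset _
  have hFL : K.frame.toFinset ⊆ (envelope K U).toList.toFinset := by
    rw [hL]; exact (subset_thicken _ 1).trans (thicken_subset_envelope K U)
  obtain ⟨hsum, hPs⟩ := facts₂Z_sum K hFL (shardPolysL K c) Ps hF hQ
  have hU : ∀ e ∈ U, SuppIn e.u K.frame.toFinset := by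
    intro e he
    rcases List.mem_append.1 he with he | he
    · rw [List.mem_flatMap] at he
      obtain ⟨Q, hQ', he⟩ := he
      exact canonNFZUses_supp K.frame Q (hQ Q hQ') e he
    · exact canonNFZUses_supp K.frame _ hPs e he
  refine wardD4CertGe_of_expansion K hwf U hU ?_
  have hfinal := canonNFZV_expansion K.frame hFL Ps.flatten (hPs.mono hFL)
  rw [polyOp_eq_zero_of_isZero _ _ hfin, zero_add] at hfinal
  rw [sum_shardPolysL K hwf hFL] at hsum
  rw [List.map_append, List.sum_append, ← hfinal, sub_eq_iff_eq_add.1 hsum]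
  abel

/-- **Sharded LOCAL closing theorem**: `symValue K ≤ e₀(1,0,8,7/8)`.  CLOSING GRAMMAR: per shard `j < shardCount K c` one
module `theorem shard_j : shardOKLV K c j P_j = true := by native_decide`; then `hwf`, `hcount : shardCount K c = m+1`,
`hfacts : ShardFactsLV K c 0 [P₀,…,P_m] := ⟨shard_0, …, shard_m, trivial⟩`, `hfin : isZero (canonNFZV K.frame [P₀,…].flatten) = true`. -/
theorem energyDensity_ge_of_shardsLV (K : SymCert) (hwf : wellFormed K = true) (c : ℕ) (Ps : List QPoly)
    (hcount : shardCount K c = Ps.length) (hfacts : ShardFactsLV K c 0 Ps)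
    (hfin : isZero (canonNFZV K.frame Ps.flatten) = true) :
    ((symValue K : ℚ) : ℝ) ≤ energyDensityTT' 1 0 8 (7 / 8) :=
  energyDensity_ge_of_windowSound_cert _ WardSlot.stub_wardWindowSound
    (wardD4CertGe_of_shardsLV K hwf c Ps hcount hfacts hfin)

/-- Kernel regressions (toys): the local one-call checker passes `toyCert` (no canon), `toyCanonCert` (canon, zero filter)
and `toyCertM` (matrix Gram); local shard 3 of `toyCertM` against its own zero-filtered canonical form. -/
example : symCheckLV toyCert = true ∧ symCheckLV toyCanonCert = true ∧ symCheckLV toyCertM = true ∧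
    shardOKLV toyCertM 0 3 (canonNFZV toyCertM.frame (shardPolyAtLFast toyCertM 0 3)) = true := by
  decide +kernel

end Summit.Ventures.CertifiedManyBodySolver.Theorems.SymReplay

end
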